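import Summits.ValiantsHypothesis.ValiantsHypothesis.Theorems.SuccinctTablesValiantCriterion
import Literature.Computability.AlgebraicComplexity.BurgisserBooleanPartsModPCircuits
import Mathlib.NumberTheory.Bertrand
import Mathlib.Algebra.Polynomial.Roots
import Mathlib.Algebra.Polynomial.BigOperators

/-!
# Succinct circulation hashing (W4 isolation, stage S1 of 4)

The per-round engine of a SUCCINCT Fenner–Gurjar–Thierauf isolation [FGT16, Lemma 2.3] for
read-once determinants in the coefficient variables of `degLEMonomials n`.  In FGT16 the weight
`w(e_i) = 2^i mod j` of the `i`-th edge kills the circulation of any `s` given cycles for some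
`j ≤ poly(n, s)`.  Here the edges are LABELLED ADVERSARIALLY by coefficient labels
`μ ∈ degLEMonomials n` (`nK` bits, `K = kBits n`), the number of patterns to kill is `2^{n^a}`,
and — this is the point of the succinct setting of `SuccinctTables.SmallIsolatingWeights` /
`weightOf` (the landed door `SuccinctTables.doorSpec_holds`) — the weight must be ONE `poly(n)`-size
`B₂`-circuit reading the label bits and writing the weight IN BINARY.

Construction: `idx μ < 2^{nK}` is the label read as a binary number; `p` is a Bertrand prime with
`2^L < p ≤ 2^{L+1}`, `L = n^a + nK + 1`; the pattern polynomial `V_π(Y) = Σ_μ π(μ) Y^{idx μ} ∈ 𝔽_p[Y]`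
of a nonzero pattern with `|π(μ)| ≤ n` is nonzero of degree `< 2^{nK}`, so the product over a family
`S` of `≤ 2^{n^a}` patterns has fewer than `p` roots and some `g ∈ 𝔽_p` is a common non-root; the
weight `h(μ) = (g^{idx μ} mod p)`, delivered as `ℓ = L + 2` bits, has circulation
`Σ_μ π(μ) h(μ) ≡ V_π(g) ≢ 0 (mod p)`.  The circuit is `g^{idx x} = ∏_t (x_t ? g^{2^t} : 1)` by the
tree's bus calculus (`HasBits.const`, `HasBits.mul`, `CktSizeVia.binop/pi_const`), of size
`ℓ + nK (ℓ + modMulCost ℓ) ≤ 23 (ℓ+2)⁴ ≤ n^{4a+19}`.  NB: the weight has `ℓ = poly(n)` BITS, i.e.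
exponential MAGNITUDE — this is exactly the binary currency of `SuccinctTables.weightOf` (stage E2
reads the weight bit by bit), not a unary one.

Main theorem: `exists_cktSize_circ_ne_zero`.  Nothing here bears on `VP ≠ VNP`; this is stage S1
of the series S1–S4 towards `SmallIsolatingWeights` for constant-free read-once determinants
(census W4, VNP ladder); the VP question (FSV18 Question 6, crux `SuccinctHittingSetsForVP`) is
untouched.
-/

noncomputable section

set_option linter.dupNamespace false

namespace Summit.ValiantsHypothesis.ValiantsHypothesis.Theorems.SuccinctCirculationHashing

open Literature.Barriers.ValiantsHypothesis Literature.Computability.AlgebraicComplexity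
  Literature.Computability.Complexity SuccinctTables

/-! ### §1 Labels as exponents -/

variable {n : ℕ}

/-- The label index `idx(x) = Σ_t [x_t] 2^t < 2^{nK}` of a bit vector on `Fin n × Fin K`
(FGT16's edge enumeration `e_1, …, e_m`, here read off the coefficient label). [cite: FennerGurjarThierauf2016, Lemma 2.3] -/
def labelIdx (x : Fin n × Fin (kBits n) → Bool) : ℕ :=
  Nat.ofBits fun t : Fin (n * kBits n) => x (finProdFinEquiv.symm t)

/-- The circulation `Σ_μ π(μ) · w(μ)` of a weight `w` against a signed label pattern `π`
(for a cycle: `+1` on odd, `-1` on even edges). [cite: FennerGurjarThierauf2016, §2.4] -/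
def circ {N : Type*} [Fintype N] (w : N → ℕ) (π : N → ℤ) : ℤ := ∑ μ, π μ * (w μ : ℤ)

/-- The pattern polynomial `V_π(Y) = Σ_μ π(μ) Y^{idx μ} ∈ 𝔽_p[Y]`. [cite: FennerGurjarThierauf2016, Lemma 2.3 / Lemma 4.2] -/
def patternPoly (p : ℕ) (π : degLEMonomials n → ℤ) : Polynomial (ZMod p) :=
  ∑ μ, Polynomial.C ((π μ : ℤ) : ZMod p) * Polynomial.X ^ labelIdx (bitsOf μ)

/-- `K = ⌊log₂ n⌋ + 1 ≤ n` for `n ≥ 1`. [folklore] -/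
theorem kBits_le (hn : 1 ≤ n) : kBits n ≤ n := by
  have h := Nat.log_lt_self 2 (show n ≠ 0 by omega)
  unfold kBits
  omega

/-- `idx x < 2^{nK}`. [folklore] -/
theorem labelIdx_lt (x : Fin n × Fin (kBits n) → Bool) : labelIdx x < 2 ^ (n * kBits n) :=
  Nat.ofBits_lt_two_pow _

/-- `idx` is injective. [folklore] -/
theorem labelIdx_injective : Function.Injective (labelIdx (n := n)) := by
  intro x y h
  have h' := BoolGadgets.ofBits_injective h
  funext b
  have hb := congrFun h' (finProdFinEquiv b)
  simpa using hb

/-- Distinct labels of degree `≤ n` have distinct bit vectors (`μ_i ≤ n < 2^K`). [cite: KumarRamyaSaptharishiTengse2022, Observation 9] -/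
theorem bitsOf_injective : Function.Injective (bitsOf (n := n)) := by
  intro μ ν h
  have hK : ∀ (μ : degLEMonomials n) (i : Fin n), (μ : Fin n →₀ ℕ) i < 2 ^ kBits n := fun μ i =>
    lt_of_le_of_lt ((Finsupp.le_degree i _).trans μ.2) (lt_two_pow_kBits n)
  unfold bitsOf at h
  have h' := congrArg KRSTSucc.decodeBits h
  rw [KRSTSucc.decodeBits_encodeBits (hK μ), KRSTSucc.decodeBits_encodeBits (hK ν)] at h'
  exact Subtype.ext (Finsupp.ext fun i => congrFun h' i)

/-! ### §2 One prime, one non-root: nonzero circulation for a whole family -/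

/-- The coefficient of `V_π` at `idx μ₀` is `π(μ₀) mod p`. [cite: FennerGurjarThierauf2016, Lemma 2.3] -/
theorem coeff_patternPoly (p : ℕ) (π : degLEMonomials n → ℤ) (μ₀ : degLEMonomials n) :
    (patternPoly p π).coeff (labelIdx (bitsOf μ₀)) = ((π μ₀ : ℤ) : ZMod p) := by
  classical
  simp only [patternPoly, Polynomial.finsetSum_coeff, Polynomial.coeff_C_mul_X_pow]
  have hinj : ∀ μ : degLEMonomials n, (labelIdx (bitsOf μ₀) = labelIdx (bitsOf μ) ↔ μ₀ = μ) :=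
    fun μ => ⟨fun h => bitsOf_injective (labelIdx_injective h), fun h => by rw [h]⟩
  simp_rw [hinj]
  simp

/-- `V_π ≠ 0` for a nonzero pattern with coefficients `|π μ| ≤ n < p`. [cite: FennerGurjarThierauf2016, Lemma 2.3] -/
theorem patternPoly_ne_zero {p : ℕ} (hp : n < p) {π : degLEMonomials n → ℤ} (hπ : π ≠ 0)
    (hc : ∀ μ, (π μ).natAbs ≤ n) : patternPoly p π ≠ 0 := by
  obtain ⟨μ₀, hμ₀⟩ := Function.ne_iff.1 hπ
  intro h0
  have hcoef := coeff_patternPoly p π μ₀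
  rw [h0, Polynomial.coeff_zero] at hcoef
  have hdvd : (p : ℤ) ∣ π μ₀ := (ZMod.intCast_zmod_eq_zero_iff_dvd _ _).1 hcoef.symm
  have habs : (π μ₀).natAbs = 0 :=
    Nat.eq_zero_of_dvd_of_lt (Int.natCast_dvd.1 hdvd) ((hc μ₀).trans_lt hp)
  exact hμ₀ (Int.natAbs_eq_zero.1 habs)

/-- `deg V_π < 2^{nK}`. [folklore] -/
theorem natDegree_patternPoly_lt (p : ℕ) (π : degLEMonomials n → ℤ) :
    (patternPoly p π).natDegree < 2 ^ (n * kBits n) := by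
  have hW : 0 < 2 ^ (n * kBits n) := Nat.two_pow_pos _
  refine lt_of_le_of_lt (Polynomial.natDegree_sum_le_of_forall_le (n := 2 ^ (n * kBits n) - 1) _ _
    fun μ _ => ?_) (Nat.sub_lt hW Nat.one_pos)
  exact (Polynomial.natDegree_C_mul_X_pow_le _ _).trans (Nat.le_sub_one_of_lt (labelIdx_lt (bitsOf μ)))

/-- A common non-root `g ∈ 𝔽_p` of `≤ s` nonzero pattern polynomials exists once `s · 2^{nK} < p`
(`card roots ≤ degree`). [cite: FennerGurjarThierauf2016, Lemma 2.3] -/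
theorem exists_forall_eval_ne_zero {p : ℕ} [Fact p.Prime] (S : Finset (degLEMonomials n → ℤ))
    (hS : ∀ π ∈ S, patternPoly p π ≠ 0) (hcard : S.card * 2 ^ (n * kBits n) < p) :
    ∃ g : ZMod p, ∀ π ∈ S, (patternPoly p π).eval g ≠ 0 := by
  classical
  haveI : NeZero p := ⟨(Fact.out : p.Prime).ne_zero⟩
  set P : Polynomial (ZMod p) := ∏ π ∈ S, patternPoly p π with hP
  have hP0 : P ≠ 0 := Finset.prod_ne_zero_iff.2 fun π hπ => hS π hπ
  have hdeg : P.natDegree < p := by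
    rw [hP]
    refine lt_of_le_of_lt (Polynomial.natDegree_prod_le _ _) ?_
    refine lt_of_le_of_lt (Finset.sum_le_card_nsmul _ _ (2 ^ (n * kBits n))
      fun π _ => (natDegree_patternPoly_lt p π).le) ?_
    simpa using hcard
  by_contra h
  push Not at h
  have hroots : ∀ g : ZMod p, g ∈ P.roots := fun g => by
    obtain ⟨π, hπ, hg⟩ := h g
    rw [Polynomial.mem_roots hP0, Polynomial.IsRoot.def, hP, Polynomial.eval_prod]
    exact Finset.prod_eq_zero hπ hg
  have h1 : (Finset.univ : Finset (ZMod p)).card ≤ P.roots.toFinset.card :=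
    Finset.card_le_card fun g _ => Multiset.mem_toFinset.2 (hroots g)
  have h2 : P.roots.toFinset.card ≤ Multiset.card P.roots := Multiset.toFinset_card_le _
  have h3 := Polynomial.card_roots' P
  rw [Finset.card_univ, ZMod.card] at h1
  omega

/-- The hashed weight `h(μ) = (g^{idx μ} mod p) ∈ [0, p)` has circulation `≡ V_π(g) (mod p)`, hence
nonzero circulation when `V_π(g) ≠ 0`. [cite: FennerGurjarThierauf2016, Lemma 2.3] -/
theorem circ_ne_zero_of_eval_ne_zero {p : ℕ} [NeZero p] (g : ZMod p) (π : degLEMonomials n → ℤ)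
    (h : (patternPoly p π).eval g ≠ 0) :
    circ (fun μ => (g ^ labelIdx (bitsOf μ)).val) π ≠ 0 := by
  intro h0
  apply h
  have hc : ((circ (fun μ => (g ^ labelIdx (bitsOf μ)).val) π : ℤ) : ZMod p)
      = (patternPoly p π).eval g := by
    simp only [circ, patternPoly, Int.cast_sum, Int.cast_mul, Int.cast_natCast, ZMod.natCast_zmod_val,
      Polynomial.eval_finsetSum, Polynomial.eval_mul, Polynomial.eval_C, Polynomial.eval_pow,
      Polynomial.eval_X]
  rw [← hc, h0, Int.cast_zero]

/-! ### §3 The hash is ONE small `B₂`-circuit (tree bus calculus, BY NAME) -/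

variable {p : ℕ}

/-- The `u`-th repeated square `g^{2^u}`, switched on by label bit `u` (else `1`). [cite: CLRS2009, §31.6] -/
def sqFactor (g : ZMod p) (x : Fin n × Fin (kBits n) → Bool) (u : ℕ) : ZMod p :=
  if h : u < n * kBits n then (if x (finProdFinEquiv.symm ⟨u, h⟩) then g ^ 2 ^ u else 1) else 1

/-- One switched constant costs `ℓ` gates (one binary gate per bit). [cite: Vollmer1999, §1.1] -/
theorem hasBits_sqFactor (ℓ : ℕ) (g : ZMod p) (u : ℕ) :
    HasBits ℓ (fun x : Fin n × Fin (kBits n) → Bool => x) (fun x => sqFactor g x u) (ℓ * 1) := by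
  unfold sqFactor
  by_cases h : u < n * kBits n
  · simp only [dif_pos h]
    have key := CktSizeVia.pi_const (κ := Fin ℓ) (s := 1)
      (e := fun x : Fin n × Fin (kBits n) → Bool => x)
      (f := fun x i => testBits ℓ
        ((if x (finProdFinEquiv.symm ⟨u, h⟩) then g ^ 2 ^ u else (1 : ZMod p)).val) i)
      (fun i => (CktSizeVia.binop (fun x : Fin n × Fin (kBits n) → Bool => x)
        (fun c _ => if c then (g ^ 2 ^ u).val.testBit i else (1 : ZMod p).val.testBit i)
        (finProdFinEquiv.symm ⟨u, h⟩) (finProdFinEquiv.symm ⟨u, h⟩)).congr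
        fun x => by
          funext z
          by_cases hx : x (finProdFinEquiv.symm ⟨u, h⟩) = true
          · simp only [hx, testBits_apply, ite_true]
          · simp only [hx, testBits_apply, Bool.false_eq_true, ite_false])
    rw [Fintype.card_fin] at key
    exact key
  · simp only [dif_neg h]
    exact HasBits.const ℓ _ (1 : ZMod p)

/-- The partial products `∏_{u<m} sqFactor` by `m` modular multiplications. [cite: CLRS2009, §31.6] -/
theorem hasBits_prod_sqFactor [NeZero p] {ℓ : ℕ} (hℓ : p ≤ 2 ^ ℓ) (g : ZMod p) : ∀ m : ℕ,
    HasBits ℓ (fun x : Fin n × Fin (kBits n) → Bool => x)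
      (fun x => ∏ u ∈ Finset.range m, sqFactor g x u) (ℓ * 1 + m * (ℓ * 1 + modMulCost ℓ))
  | 0 => by
    simpa using HasBits.const ℓ (fun x : Fin n × Fin (kBits n) → Bool => x) (1 : ZMod p)
  | m + 1 => by
    have h := HasBits.mul hℓ (hasBits_prod_sqFactor hℓ g m) (hasBits_sqFactor ℓ g m)
    refine (h.congr fun x => (Finset.prod_range_succ _ _).symm).of_le (le_of_eq ?_)
    ring

/-- `∏_{u < nK} sqFactor g x u = g^{idx x}` (binary exponentiation). [cite: CLRS2009, §31.6] -/
theorem prod_sqFactor_eq (g : ZMod p) (x : Fin n × Fin (kBits n) → Bool) :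
    ∏ u ∈ Finset.range (n * kBits n), sqFactor g x u = g ^ labelIdx x := by
  rw [labelIdx, BoolGadgets.ofBits_eq_sum, ← Finset.prod_pow_eq_pow_sum,
    ← Fin.prod_univ_eq_prod_range (fun u => sqFactor g x u)]
  refine Finset.prod_congr rfl fun t _ => ?_
  simp only [sqFactor, dif_pos t.2, Fin.eta]
  cases x (finProdFinEquiv.symm t) <;> simp

/-- `g^{idx x} = ∏_t (x_t ? g^{2^t} : 1)` is available in binary from the label bits at cost
`ℓ + nK (ℓ + modMulCost ℓ)` (`HasBits.const`, `HasBits.mul`, one gate per bit for each muxed constant).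
[cite: CLRS2009, §31.6] -/
theorem hasBits_pow_labelIdx {p ℓ : ℕ} [NeZero p] (hℓ : p ≤ 2 ^ ℓ) (g : ZMod p) :
    HasBits ℓ (fun x : Fin n × Fin (kBits n) → Bool => x) (fun x => g ^ labelIdx x)
      (ℓ * 1 + n * kBits n * (ℓ * 1 + modMulCost ℓ)) :=
  (hasBits_prod_sqFactor hℓ g (n * kBits n)).congr fun x => prod_sqFactor_eq g x

/-- The bits of `g^{idx x} mod p` as an ordinary `B₂`-circuit. [cite: Burgisser2000TCS, §5 (A3)] -/
theorem cktSize_hashBits {p ℓ : ℕ} [NeZero p] (hℓ : p ≤ 2 ^ ℓ) (g : ZMod p) :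
    CktSize B2 (fun x : Fin n × Fin (kBits n) → Bool => testBits ℓ (g ^ labelIdx x).val)
      (ℓ * 1 + n * kBits n * (ℓ * 1 + modMulCost ℓ)) :=
  CktSizeVia.toCktSize (hasBits_pow_labelIdx hℓ g)

/-- Reading `ℓ` bits back: `ofBits (testBits ℓ N) = N` for `N < 2^ℓ`. [folklore] -/
theorem ofBits_testBits_of_lt {ℓ N : ℕ} (h : N < 2 ^ ℓ) : Nat.ofBits (testBits ℓ N) = N := by
  rw [show testBits ℓ N = fun i : Fin ℓ => N.testBit i from rfl, Nat.ofBits_testBit, Nat.mod_eq_of_lt h]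

/-- The gate count is at most `23 (ℓ + 2)⁴` once `nK ≤ ℓ`. [folklore] -/
theorem cost_le {W ℓ : ℕ} (hW : W ≤ ℓ) : ℓ * 1 + W * (ℓ * 1 + modMulCost ℓ) ≤ 23 * (ℓ + 2) ^ 4 := by
  calc ℓ * 1 + W * (ℓ * 1 + modMulCost ℓ) ≤ ℓ * 1 + ℓ * (ℓ * 1 + modMulCost ℓ) := by gcongr
    _ ≤ 23 * (ℓ + 2) ^ 4 := by
      simp only [modMulCost, modMulStepCost, modAddCost]
      ring_nf
      nlinarith [sq_nonneg (ℓ : ℕ), Nat.zero_le (ℓ ^ 3), Nat.zero_le (ℓ ^ 4)]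

/-- **S1 MAIN — succinct circulation hashing.**  For every `a` there are `c, n₁` such that for
`n ≥ n₁` and every family `S` of at most `2^{n^a}` nonzero label patterns with coefficients
`|π μ| ≤ n`, ONE `B₂`-circuit of size `≤ n^c` on the `nK` label bits with `ℓ ≤ n^c` output bits has a
binary weight with nonzero circulation against every `π ∈ S`.  (FGT16 Lemma 2.3 kills `s` cycles
with weights `2^e mod j`, `j = O(n² s)`; here the labels are adversarial `nK`-bit strings, the modulus
is a Bertrand prime with `nK + n^a + 2` bits, and obliviousness is not needed: `∃` after `∀ S`.)
[cite: FennerGurjarThierauf2016, Lemma 2.3] -/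
theorem exists_cktSize_circ_ne_zero (a : ℕ) : ∃ c n₁ : ℕ, ∀ n : ℕ, n₁ ≤ n →
    ∀ S : Finset (degLEMonomials n → ℤ), S.card ≤ 2 ^ n ^ a →
      (∀ π ∈ S, π ≠ 0) → (∀ π ∈ S, ∀ μ, (π μ).natAbs ≤ n) →
      ∃ (ℓ : ℕ) (f : (Fin n × Fin (kBits n) → Bool) → Fin ℓ → Bool),
        ℓ ≤ n ^ c ∧ CktSize B2 f (n ^ c) ∧
        ∀ π ∈ S, circ (fun μ => Nat.ofBits (f (bitsOf μ))) π ≠ 0 := by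
  refine ⟨4 * a + 19, 2, fun n hn S hS hS0 hSc => ?_⟩
  have hn1 : 1 ≤ n := by omega
  -- the word length of a label and the size of the prime
  set W := n * kBits n with hW
  have hK1 : 1 ≤ kBits n := by unfold kBits; omega
  have hWn : n ≤ W := by rw [hW]; exact Nat.le_mul_of_pos_right n hK1
  have hWle : W ≤ n ^ 2 := by rw [hW, pow_two]; exact Nat.mul_le_mul_left n (kBits_le hn1)
  set L := n ^ a + W + 1 with hL
  obtain ⟨p, hp, hpl, hpu⟩ := Nat.exists_prime_lt_and_le_two_mul (2 ^ L) (by positivity)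
  haveI := Fact.mk hp
  haveI : NeZero p := ⟨hp.ne_zero⟩
  set ℓ := L + 1 with hℓ
  have hpℓ : p ≤ 2 ^ ℓ := by rw [hℓ, pow_succ]; omega
  -- a common non-root of the pattern polynomials
  have hnp : n < p := by
    have h1 : n < 2 ^ n := Nat.lt_two_pow_self
    have h2 : 2 ^ n ≤ 2 ^ L := Nat.pow_le_pow_right (by norm_num) (by omega)
    omega
  have hV : ∀ π ∈ S, patternPoly p π ≠ 0 := fun π hπ =>
    patternPoly_ne_zero hnp (hS0 π hπ) (hSc π hπ)
  have hcard : S.card * 2 ^ W < p := by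
    calc S.card * 2 ^ W ≤ 2 ^ n ^ a * 2 ^ W := Nat.mul_le_mul_right _ hS
      _ = 2 ^ (n ^ a + W) := (pow_add 2 _ _).symm
      _ < 2 ^ L := Nat.pow_lt_pow_right (by norm_num) (by omega)
      _ < p := hpl
  obtain ⟨g, hg⟩ := exists_forall_eval_ne_zero S hV hcard
  -- sizes
  have hℓ2 : ℓ + 2 ≤ 3 * n ^ (a + 2) := by
    have h1 : n ^ a ≤ n ^ (a + 2) := Nat.pow_le_pow_right hn1 (by omega)
    have h2 : n ^ 2 ≤ n ^ (a + 2) := Nat.pow_le_pow_right hn1 (by omega)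
    have h3 : 2 ^ 2 ≤ n ^ 2 := Nat.pow_le_pow_left hn 2
    have h4 : ℓ + 2 = n ^ a + W + 4 := by omega
    rw [h4]
    linarith
  have h11 : 1863 ≤ n ^ 11 := le_trans (by norm_num) (Nat.pow_le_pow_left hn 11)
  have hpow : 3 * n ^ (a + 2) ≤ n ^ (4 * a + 19) := by
    calc 3 * n ^ (a + 2) ≤ n ^ 11 * n ^ (a + 2) := Nat.mul_le_mul_right _ (le_trans (by norm_num) h11)
      _ = n ^ (a + 13) := by ring
      _ ≤ n ^ (4 * a + 19) := Nat.pow_le_pow_right hn1 (by omega)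
  have hcost : ℓ * 1 + W * (ℓ * 1 + modMulCost ℓ) ≤ n ^ (4 * a + 19) := by
    have hWℓ : W ≤ ℓ := by rw [hℓ, hL]; omega
    calc ℓ * 1 + W * (ℓ * 1 + modMulCost ℓ) ≤ 23 * (ℓ + 2) ^ 4 := cost_le hWℓ
      _ ≤ 23 * (3 * n ^ (a + 2)) ^ 4 := by gcongr
      _ = 1863 * n ^ (4 * a + 8) := by ring
      _ ≤ n ^ 11 * n ^ (4 * a + 8) := Nat.mul_le_mul_right _ h11
      _ = n ^ (4 * a + 19) := by ring
  -- the circuit and its weight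
  refine ⟨ℓ, fun x => testBits ℓ (g ^ labelIdx x).val, by omega, (cktSize_hashBits hpℓ g).of_le hcost,
    fun π hπ => ?_⟩
  have hz : ∀ z : ZMod p, Nat.ofBits (testBits ℓ z.val) = z.val := fun z =>
    ofBits_testBits_of_lt ((ZMod.val_lt z).trans_le hpℓ)
  simp_rw [hz]
  exact circ_ne_zero_of_eval_ne_zero g π (hg π hπ)

end Summit.ValiantsHypothesis.ValiantsHypothesis.Theorems.SuccinctCirculationHashing
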